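import Literature.ComputerArithmetic.OzakiOgitaOishiRump2012.ErrorFreeTransformation
import Mathlib.Algebra.Order.Floor.Ring

/-!
# Uchino–Ozaki–Imamura 2025: the Ozaki scheme on an integer matrix multiplication unit
# (ozIMMU: INT8 slices, exact INT32 products, group-wise error-free accumulation, FP64 final sum)

HONEST FRAMING (ENGINES group, engine `quad`, part QUAD-4 — batched evaluation / code-generation
kernels / profiler): shared numerical engines serving client cells; rigour lives in the verifiers;
every published number belongs to a client cell's ledger, not to the engines group. This file types,
at FORMAT LEVEL, the arithmetic core of DGEMM EMULATION ON INTEGER TENSOR CORES: a double-precision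
matrix is sliced row-wise, by BIT MASKING relative to the row scale `μ''ᵢ = 2^⌊log₂ maxⱼ|aᵢⱼ|⌋`, into
`k` signed `β`-bit INTEGER matrices `A''ₛ` (`A = diag(μ'')·Σₛ 2^{1−βs}A''ₛ + V_k`, eq. (5)); every slice
product `A''ₛB''ₜ` is an exact INT32 computation as long as no partial sum leaves `𝕀₃₂`, which the
choice `β = min(7, ⌊(31 − log₂ n)/2⌋)` (4) guarantees for one product and the constant
`r = 2^{31−2β−⌈log₂ n⌉}` (12) guarantees for a whole group of `r` products of equal weight `s + t = g`
(§3.2, (31)–(32)); the truncation error of the `k`-slice scheme is `≤ 4(k+1)n2^{−βk}·g fᵀ` (18); the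
FP64 accumulation of the `k(k+1)/2` exactly computed terms costs `(k(k+1)/2 − 1)u|A||B|` in any order
(22), and its leading groups `s + t ≤ k'+1` are summed WITHOUT ANY ROUNDING ERROR, in any order, as soon
as `2u·ufp(8n) ≤ 2^{2−β(k'+1)}` (23)–(29).

SOURCE. Y. Uchino, K. Ozaki, T. Imamura, *Performance enhancement of the Ozaki Scheme on integer matrix
multiplication unit*, Int. J. High Perform. Comput. Appl. 39(3) (2025) 462–476,
doi 10.1177/10943420241313064 = arXiv:2409.13313 [cite: UchinoOzakiImamura2025] (read from the arXiv
TeX source; EQUATION NUMBERS below are the consecutive numbers of that source — (1) `Vᵢ, Wᵢ`; (4) `β`;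
(5)–(6) the integer slicings of `A`, `B`; (7) the `k`-slice approximation; (11)–(12) group factorisation
and `r`; (13)–(15) §5 preliminaries; (16)–(18) truncation; (21)–(22) accumulation; (23)–(29) error-free
leading groups; (30) the improved accumulation constant; (31)–(32) INT32 safety — and every tag also
names the section). The sliced algorithm itself (Algorithms 3–4, "ozIMMU") is H. Ootomo, K. Ozaki,
R. Yokota, *DGEMM on integer matrix multiplication unit*, IJHPCA 38(4) (2024) 297–313
[cite: OotomoOzakiYokota2024]; the any-order summation bound (14) is `JeannerodRump2013.proposition31`
and the grid mechanism of (15)/(23) is the one of `OzakiOgitaOishiRump2012.dotTree_eval_eq_exact`.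

DICTIONARY (paper ↦ this file).
* `𝕀_N` ("−2^{N−1} ≤ i ≤ 2^{N−1} − 1") ↦ `InInt N z`; INT8 inputs / INT32 accumulators are modelled by
  integers together with the explicit range facts (31)–(32) ("no error occurs in integer arithmetic,
  barring overflow" ↦ `AccTree.evalWrap_eq_exact`: two's-complement accumulation in any order returns
  the exact sum when every partial sum is in `𝕀₃₂`).
* `F = F₆₄`, `u`, `fl`, `ufp` ↦ `IsFloat p emin`, `unitRoundoff p`, any `fl` with `IsRoundNearest p emin fl`,
  `RumpOgitaOishi2008.ufp` (the results are stated for a general precision `p`; FP64 is `p = 53`);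
  "neither overflow nor underflow occurs" (§5) ↦ overflow is absent from the model, underflow is the
  explicit hypotheses `emin ≤ …` on the grids used.
* `log₂ n` in (4) ↦ `⌈log₂ n⌉ = Nat.clog 2 n` (for the paper's power-of-two dimensions they agree, and
  `⌊(31 − log₂ n)/2⌋ = ⌊(31 − ⌈log₂ n⌉)/2⌋` for every `n ≥ 1`); `β` ↦ `beta n`; `r` (12) ↦ `rConst β n`.
* Row scale `μ''ᵢ = gᵢ = 2^{Mᵢ}`, column scale `ν''ⱼ = fⱼ = 2^{Nⱼ}` ↦ integer exponents `M i`, `N j` with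
  `|aᵢₗ| < 2^{Mᵢ+1}`, `|bₗⱼ| < 2^{Nⱼ+1}` (which `Mᵢ = ⌊log₂ maxₗ|aᵢₗ|⌋` satisfies: `abs_lt_two_zpow_log_succ`).
* "extract the `s`-th `β` bits of the mantissa of `aᵢⱼ` via bit masking" (Algorithm 3) ↦
  `sliceInt M β s a = sgn(a)·(⌊|a|/2^{M+1−βs}⌋ mod 2^β)` (shift and mask); `(Aₛ)ᵢₗ = 2^{Mᵢ}2^{1−βs}(A''ₛ)ᵢₗ`
  ↦ `partEntry`; `V_k` (1) ↦ `remEntry … k a = a − Σ_{s≤k} partEntry … s a`.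
* "`T_k` = the FP64 accumulation of the `k(k+1)/2` exactly computed matrices `AᵢBⱼ`, `i + j ≤ k + 1`"
  ↦ for each entry an arbitrary `JeannerodRump2018.SumTree` (any order) resp. `JeannerodRump2013.DotTree`
  whose leaves are those terms.

TYPED AND PROVED: (4) with `β ≤ 7`, `β ≥ 1 ⟺ n ≤ 2^29`, `2β + ⌈log₂n⌉ ≤ 31`; the bit-mask slicing with
`|A''ₛ| ≤ 2^β − 1` (31), the identity (5) (= (1) telescoped), the bounds (16)–(17), the grid (24), the
sign coherence behind (21) (`Σₛ|Aₛ| + |V_k| = |A|`), and termination (`V_k = 0` once the slices pass the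
last bit); INT32 safety of one slice product under (4) and of `q ≤ r` products under (12) ((31)–(32)),
for every partial sum, plus exactness of wrapped two's-complement accumulation in range; the group
factorisation (11); the truncation identity and bound (16)–(18); the any-order accumulation bound (22)
with `Σ|AᵢBⱼ| ≤ |A||B|` from (21); (24)–(28) and the error-free leading groups (29) ⟹ (23), in the strong
form "every evaluation order of the leading partial sum is exact"; the improved constant of (30) in the
form our derivation gives (see `accumulation_bound_improved`: the printed constant carries an extra
`−1` that the count of inexact additions does not justify; we prove `½k(k+1) − ½k'(k'+1)`); the chunk
count `w = ⌈k/r⌉(k − (r/2)⌊(k−1)/r⌋) = Σ_{g} ⌈(g−1)/r⌉` of §5.2 and its `(w − 1)u` bound.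
NOT TYPED: the round-to-nearest splittings (Algorithms 6 and 8; their analysis "would be the same"),
the probabilistic `√n u` bound, the `≈ / ≲` statements (19)–(20), all timings, figures and GPU details.
-/

namespace Literature.ComputerArithmetic.UchinoOzakiImamura2025

open Literature.ComputerArithmetic.JeannerodRump2018
open Literature.ComputerArithmetic.RumpOgitaOishi2008
open Literature.ComputerArithmetic.JeannerodRump2013 (DotTree proposition31 unitRoundoff_pos)
open Literature.ComputerArithmetic.OzakiOgitaOishiRump2012 (mul_expansion onGrid_mul
  dotTree_eval_eq_exact le_two_pow_clog)
open Finset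
open scoped Matrix

variable {p : ℕ} {emin : ℤ} {fl : ℚ → ℚ}

/-! ### §2: signed `N`-bit integers and the slice width `β` (4) -/

/-- `𝕀_N`, the `N`-bit signed integers: "`−2^{N−1} ≤ i ≤ 2^{N−1} − 1` for all `i ∈ 𝕀_N`".
[cite: UchinoOzakiImamura2025, §2 (definition of 𝕀_N)] -/
def InInt (N : ℕ) (z : ℤ) : Prop := -(2 : ℤ) ^ (N - 1) ≤ z ∧ z ≤ (2 : ℤ) ^ (N - 1) - 1

/-- A modulus bound `|z| ≤ 2^{N−1} − 1` puts `z` in `𝕀_N`. [cite: UchinoOzakiImamura2025, §2 (definition of 𝕀_N)] -/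
theorem inInt_of_abs_le {N : ℕ} {z : ℤ} (h : |z| ≤ (2 : ℤ) ^ (N - 1) - 1) : InInt N z := by
  have := abs_le.mp h
  exact ⟨by linarith, this.2⟩

/-- EQ. (4): the slice width `β := min(7, ⌊(31 − log₂ n)/2⌋)` (with `log₂ n` read as `⌈log₂ n⌉`).
[cite: UchinoOzakiImamura2025, §2 eq. (4)] -/
def beta (n : ℕ) : ℕ := min 7 ((31 - Nat.clog 2 n) / 2)

/-- `β ≤ 7`: a slice and its sign fit an INT8. [cite: UchinoOzakiImamura2025, §2 eq. (4)] -/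
theorem beta_le_seven (n : ℕ) : beta n ≤ 7 := min_le_left _ _

/-- "Assume that `β ≥ 1`, i.e., `n ≤ 2^29`." [cite: UchinoOzakiImamura2025, §2 (after eq. (4))] -/
theorem one_le_beta_iff (n : ℕ) : 1 ≤ beta n ↔ n ≤ 2 ^ 29 := by
  unfold beta
  rw [← Nat.clog_le_iff_le_pow (by norm_num : 1 < 2)]
  constructor
  · intro h; have := le_min_iff.mp h; omega
  · intro h; exact le_min (by norm_num) (by omega)

/-- The point of (4): `2β + ⌈log₂ n⌉ ≤ 31` (for `β ≥ 1`, i.e. `n ≤ 2^29`), so that `n` products of two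
`β`-bit integers cannot leave `𝕀₃₂`. [cite: UchinoOzakiImamura2025, §2 eq. (4) and §5.2] -/
theorem two_mul_beta_add_clog_le {n : ℕ} (hn : n ≤ 2 ^ 29) : 2 * beta n + Nat.clog 2 n ≤ 31 := by
  have hc : Nat.clog 2 n ≤ 29 := (Nat.clog_le_iff_le_pow (by norm_num : 1 < 2)).mpr hn
  unfold beta
  have := min_le_right 7 ((31 - Nat.clog 2 n) / 2)
  omega

/-- Consequently `n·2^{2β} ≤ 2^31`. [cite: UchinoOzakiImamura2025, §2 eq. (4) and §5.2] -/
theorem mul_two_pow_two_mul_beta_le {n : ℕ} (hn : n ≤ 2 ^ 29) : n * 2 ^ (2 * beta n) ≤ 2 ^ 31 := by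
  calc n * 2 ^ (2 * beta n) ≤ 2 ^ Nat.clog 2 n * 2 ^ (2 * beta n) :=
        Nat.mul_le_mul_right _ (le_two_pow_clog n)
    _ = 2 ^ (Nat.clog 2 n + 2 * beta n) := by rw [pow_add]
    _ ≤ 2 ^ 31 := Nat.pow_le_pow_right (by norm_num) (by have := two_mul_beta_add_clog_le hn; omega)

/-! ### §2, Algorithm 3 (Ootomo's bit-mask slicing), arithmetised -/

/-- The sign factor of an entry (`+1` for `a ≥ 0`, `−1` for `a < 0`). [cite: UchinoOzakiImamura2025, §2 Algorithm 3] -/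
def sgn (a : ℚ) : ℚ := if a < 0 then -1 else 1

/-- `sgn a · |a| = a`. [cite: UchinoOzakiImamura2025, §2 Algorithm 3] -/
theorem sgn_mul_abs (a : ℚ) : sgn a * |a| = a := by
  unfold sgn
  split_ifs with h
  · rw [abs_of_neg h]; ring
  · rw [abs_of_nonneg (not_lt.mp h)]; ring

/-- `|sgn a| = 1`. [cite: UchinoOzakiImamura2025, §2 Algorithm 3] -/
theorem abs_sgn (a : ℚ) : |sgn a| = 1 := by
  unfold sgn; split_ifs <;> simp

/-- The bit level of slice `s` of a row with scale `μ'' = 2^M`: `e_s = M + 1 − βs` (slice `s` holds the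
mantissa bits of weights `2^{e_s + β − 1}, …, 2^{e_s}`; `(A_s)ᵢₗ = 2^{−βs+1}μ''ᵢ·(A''ₛ)ᵢₗ = 2^{e_s}(A''ₛ)ᵢₗ`).
[cite: UchinoOzakiImamura2025, §2 eq. (5) and Algorithm 3] -/
def lvl (M : ℤ) (β s : ℕ) : ℤ := M + 1 - (β * s : ℕ)

/-- `e_{s+1} + β = e_s`. [cite: UchinoOzakiImamura2025, §2 eq. (5)] -/
theorem lvl_succ (M : ℤ) (β s : ℕ) : lvl M β (s + 1) + β = lvl M β s := by
  unfold lvl; push_cast; ring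

/-- `e_0 = M + 1`. [cite: UchinoOzakiImamura2025, §2 eq. (5)] -/
theorem lvl_zero (M : ℤ) (β : ℕ) : lvl M β 0 = M + 1 := by unfold lvl; simp

/-- "Extract the `s`-th `β` bits of the mantissa of `aᵢⱼ` via bit masking and hold those as an INT8
variable `(A''ₛ)ᵢⱼ`": shift `|a|` down to level `e_s`, drop the fraction, keep the lowest `β` bits, and
restore the sign. [cite: UchinoOzakiImamura2025, §2 Algorithm 3 (line 5) and eq. (5)] -/
def sliceInt (M : ℤ) (β s : ℕ) (a : ℚ) : ℤ :=
  (if a < 0 then -1 else 1) * (⌊|a| / (2 : ℚ) ^ lvl M β s⌋ % (2 : ℤ) ^ β)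

/-- The floating-point slice `(A_s)ᵢₗ := 2^{−βs+1}μ''ᵢ(A''ₛ)ᵢₗ = 2^{e_s}(A''ₛ)ᵢₗ`.
[cite: UchinoOzakiImamura2025, §2 eq. (5) and §2 (definition of Aᵢ after Algorithm 4)] -/
def partEntry (M : ℤ) (β s : ℕ) (a : ℚ) : ℚ := (sliceInt M β s a : ℚ) * (2 : ℚ) ^ lvl M β s

/-- The truncation error after `k` slices, eq. (1): `(V_k)ᵢₗ := aᵢₗ − Σ_{s=1}^{k} (A_s)ᵢₗ`.
[cite: UchinoOzakiImamura2025, §2 eq. (1)] -/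
def remEntry (M : ℤ) (β k : ℕ) (a : ℚ) : ℚ := a - ∑ s ∈ range k, partEntry M β (s + 1) a

/-- Truncation of a nonnegative number to the grid `2^eℤ` (the mantissa bits of weight `≥ 2^e`).
[cite: UchinoOzakiImamura2025, §2 Algorithm 3] -/
def trunc (e : ℤ) (x : ℚ) : ℚ := (⌊x / (2 : ℚ) ^ e⌋ : ℚ) * (2 : ℚ) ^ e

/-- SHIFT AND MASK = a base-`2^β` digit: `0 ≤ ⌊x/2^e⌋ mod 2^β ≤ 2^β − 1` and
`2^e·(⌊x/2^e⌋ mod 2^β) = trunc_e(x) − trunc_{e+β}(x)`. [cite: UchinoOzakiImamura2025, §2 Algorithm 3 (line 5)] -/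
theorem digit_spec (x : ℚ) (e : ℤ) (β : ℕ) :
    0 ≤ ⌊x / (2 : ℚ) ^ e⌋ % (2 : ℤ) ^ β ∧ ⌊x / (2 : ℚ) ^ e⌋ % (2 : ℤ) ^ β ≤ (2 : ℤ) ^ β - 1 ∧
      ((⌊x / (2 : ℚ) ^ e⌋ % (2 : ℤ) ^ β : ℤ) : ℚ) * (2 : ℚ) ^ e = trunc e x - trunc (e + β) x := by
  have h2 : (0 : ℤ) < (2 : ℤ) ^ β := by positivity
  refine ⟨Int.emod_nonneg _ h2.ne', by have := Int.emod_lt_of_pos ⌊x / (2 : ℚ) ^ e⌋ h2; omega, ?_⟩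
  have hdiv : ⌊x / (2 : ℚ) ^ (e + β)⌋ = ⌊x / (2 : ℚ) ^ e⌋ / (2 : ℤ) ^ β := by
    rw [zpow_add₀ (by norm_num : (2 : ℚ) ≠ 0), ← div_div, zpow_natCast]
    have := Int.floor_div_natCast (x / (2 : ℚ) ^ e) (2 ^ β)
    push_cast at this
    rw [this]
  unfold trunc
  rw [hdiv, Int.emod_def, zpow_add₀ (by norm_num : (2 : ℚ) ≠ 0), zpow_natCast]
  push_cast
  ring

/-- (31): every slice is a signed `β`-bit integer, `|(A''ₛ)ᵢₗ| ≤ 2^β − 1` (`A''ₛ ∈ 𝕀_{β+1}^{m×n}`).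
[cite: UchinoOzakiImamura2025, §5.2 eq. (31) and the display after (32)] -/
theorem abs_sliceInt_le (M : ℤ) (β s : ℕ) (a : ℚ) : |sliceInt M β s a| ≤ (2 : ℤ) ^ β - 1 := by
  obtain ⟨h0, h1, -⟩ := digit_spec |a| (lvl M β s) β
  unfold sliceInt
  split_ifs
  · rw [abs_mul, show |(-1 : ℤ)| = 1 by simp, one_mul, abs_of_nonneg h0]; exact h1
  · rw [one_mul, abs_of_nonneg h0]; exact h1

/-- With `β ≤ 7` the slices are INT8 data: `(A''ₛ)ᵢₗ ∈ 𝕀₈`. [cite: UchinoOzakiImamura2025, §2 eq. (5) (A''ᵢ ∈ 𝕀₈^{m×n})] -/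
theorem inInt_eight_sliceInt (M : ℤ) {β : ℕ} (hβ : β ≤ 7) (s : ℕ) (a : ℚ) : InInt 8 (sliceInt M β s a) := by
  refine inInt_of_abs_le (le_trans (abs_sliceInt_le M β s a) ?_)
  have : (2 : ℤ) ^ β ≤ 2 ^ 7 := pow_le_pow_right₀ (by norm_num) hβ
  simpa using this

/-- One slice in closed form: `(A_s)ᵢₗ = sgn(a)·(trunc_{e_s}|a| − trunc_{e_{s−1}}|a|)`.
[cite: UchinoOzakiImamura2025, §2 Algorithm 3 and eq. (5)] -/
theorem partEntry_eq (M : ℤ) (β s : ℕ) (a : ℚ) :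
    partEntry M β (s + 1) a = sgn a * (trunc (lvl M β (s + 1)) |a| - trunc (lvl M β s) |a|) := by
  obtain ⟨-, -, h⟩ := digit_spec |a| (lvl M β (s + 1)) β
  rw [lvl_succ] at h
  unfold partEntry sliceInt sgn
  push_cast
  split_ifs <;> rw [mul_assoc, h]

/-- The slices telescope: `Σ_{s=1}^{k} (A_s)ᵢₗ = sgn(a)·(trunc_{e_k}|a| − trunc_{e_0}|a|)`.
[cite: UchinoOzakiImamura2025, §2 eq. (5)] -/
theorem sum_partEntry_eq (M : ℤ) (β k : ℕ) (a : ℚ) :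
    ∑ s ∈ range k, partEntry M β (s + 1) a = sgn a * (trunc (lvl M β k) |a| - trunc (lvl M β 0) |a|) := by
  induction k with
  | zero => simp
  | succ k ih => rw [sum_range_succ, ih, partEntry_eq]; ring

/-- Below the leading bit nothing is masked away: `|a| < 2^{M+1}` ⟹ `trunc_{e_0}|a| = 0`.
[cite: UchinoOzakiImamura2025, §2 Algorithm 3 (line 2, μ''ᵢ = 2^⌊log₂ maxⱼ|aᵢⱼ|⌋)] -/
theorem trunc_lvl_zero (M : ℤ) (β : ℕ) {a : ℚ} (ha : |a| < (2 : ℚ) ^ (M + 1)) : trunc (lvl M β 0) |a| = 0 := by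
  unfold trunc
  rw [lvl_zero]
  have h2 := two_zpow_pos (M + 1)
  have : ⌊|a| / (2 : ℚ) ^ (M + 1)⌋ = 0 := by
    rw [Int.floor_eq_zero_iff]
    exact ⟨div_nonneg (abs_nonneg a) h2.le, by rw [div_lt_one h2]; exact ha⟩
  rw [this]; simp

/-- `0 ≤ x − trunc_e(x) < 2^e`. [cite: UchinoOzakiImamura2025, §5.1 eq. (16) (Figure 7)] -/
theorem sub_trunc_bounds (e : ℤ) (x : ℚ) : 0 ≤ x - trunc e x ∧ x - trunc e x < (2 : ℚ) ^ e := by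
  unfold trunc
  have h2 := two_zpow_pos e
  have hf := Int.floor_le (x / (2 : ℚ) ^ e)
  have hl := Int.lt_floor_add_one (x / (2 : ℚ) ^ e)
  rw [le_div_iff₀ h2] at hf
  rw [div_lt_iff₀ h2] at hl
  constructor <;> nlinarith

/-- EQ. (5) FOR AN ENTRY = (1) telescoped: `a = Σ_{s=1}^{k} 2^{e_s}(A''ₛ) + V_k` with the explicit
remainder `V_k = sgn(a)(|a| − trunc_{e_k}|a|)`. [cite: UchinoOzakiImamura2025, §2 eqs. (1), (5)] -/
theorem remEntry_eq (M : ℤ) (β k : ℕ) {a : ℚ} (ha : |a| < (2 : ℚ) ^ (M + 1)) :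
    remEntry M β k a = sgn a * (|a| - trunc (lvl M β k) |a|) := by
  unfold remEntry
  rw [sum_partEntry_eq, trunc_lvl_zero M β ha]
  have := sgn_mul_abs a
  linear_combination -this

/-- EQ. (5)/(1): `aᵢₗ = Σ_{s=1}^{k} (A_s)ᵢₗ + (V_k)ᵢₗ`. [cite: UchinoOzakiImamura2025, §2 eqs. (1), (5)] -/
theorem eq_sum_partEntry_add_rem (M : ℤ) (β k : ℕ) (a : ℚ) :
    a = (∑ s ∈ range k, partEntry M β (s + 1) a) + remEntry M β k a := by
  unfold remEntry; ring

/-- EQ. (16): `|V_k| ≤ 2^{−βk+1} g eᵀ` — indeed `|(V_k)ᵢₗ| < 2^{e_k} = 2^{1−βk}gᵢ`.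
[cite: UchinoOzakiImamura2025, §5.1 eq. (16)] -/
theorem abs_remEntry_lt (M : ℤ) (β k : ℕ) {a : ℚ} (ha : |a| < (2 : ℚ) ^ (M + 1)) :
    |remEntry M β k a| < (2 : ℚ) ^ lvl M β k := by
  rw [remEntry_eq M β k ha, abs_mul, abs_sgn, one_mul]
  obtain ⟨h0, h1⟩ := sub_trunc_bounds (lvl M β k) |a|
  rw [abs_of_nonneg h0]; exact h1

/-- EQ. (17): `|A_s| ≤ 2^{−β(s−1)+1} g eᵀ` — indeed `|(A_s)ᵢₗ| ≤ (2^β − 1)2^{e_s} < 2^{e_{s−1}}`.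
[cite: UchinoOzakiImamura2025, §5.1 eq. (17)] -/
theorem abs_partEntry_le (M : ℤ) (β s : ℕ) (a : ℚ) :
    |partEntry M β (s + 1) a| ≤ ((2 : ℚ) ^ β - 1) * (2 : ℚ) ^ lvl M β (s + 1) ∧
      |partEntry M β (s + 1) a| < (2 : ℚ) ^ lvl M β s := by
  have h2 := two_zpow_pos (lvl M β (s + 1))
  have h1 : |partEntry M β (s + 1) a| ≤ ((2 : ℚ) ^ β - 1) * (2 : ℚ) ^ lvl M β (s + 1) := by
    unfold partEntry
    rw [abs_mul, abs_of_pos h2]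
    refine mul_le_mul_of_nonneg_right ?_ h2.le
    have := abs_sliceInt_le M β (s + 1) a
    rw [← Int.cast_abs]; exact_mod_cast this
  refine ⟨h1, lt_of_le_of_lt h1 ?_⟩
  rw [← lvl_succ M β s, zpow_add₀ (by norm_num : (2 : ℚ) ≠ 0), zpow_natCast, mul_comm]
  exact mul_lt_mul_of_pos_left (by linarith) h2

/-- EQ. (24): `(A_s)ᵢₗ ∈ 2^{−sβ+1}gᵢℤ = 2^{e_s}ℤ`. [cite: UchinoOzakiImamura2025, §5.1 eq. (24)] -/
theorem onGrid_partEntry (M : ℤ) (β s : ℕ) (a : ℚ) : OnGrid ((2 : ℚ) ^ lvl M β s) (partEntry M β s a) :=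
  ⟨sliceInt M β s a, rfl⟩

/-- SIGN COHERENCE of bit masking, the fact behind (21) `|A| = Σᵢ|Aᵢ|`: all slices and the remainder
carry the sign of `a`, so `Σ_{s=1}^{k}|(A_s)ᵢₗ| + |(V_k)ᵢₗ| = |aᵢₗ|` exactly (and `= Σ|A_s|` once `V_k = 0`).
[cite: UchinoOzakiImamura2025, §5.1 eq. (21)] -/
theorem sum_abs_partEntry_add_abs_rem (M : ℤ) (β k : ℕ) {a : ℚ} (ha : |a| < (2 : ℚ) ^ (M + 1)) :
    (∑ s ∈ range k, |partEntry M β (s + 1) a|) + |remEntry M β k a| = |a| := by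
  have hmono : ∀ s, trunc (lvl M β s) |a| ≤ trunc (lvl M β (s + 1)) |a| := by
    intro s
    obtain ⟨h0, -, h⟩ := digit_spec |a| (lvl M β (s + 1)) β
    rw [lvl_succ] at h
    have : (0 : ℚ) ≤ ((⌊|a| / (2 : ℚ) ^ lvl M β (s + 1)⌋ % (2 : ℤ) ^ β : ℤ) : ℚ) * (2 : ℚ) ^ lvl M β (s + 1) :=
      mul_nonneg (by exact_mod_cast h0) (two_zpow_pos _).le
    linarith
  have habs : ∀ s, |partEntry M β (s + 1) a| = trunc (lvl M β (s + 1)) |a| - trunc (lvl M β s) |a| := by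
    intro s
    rw [partEntry_eq, abs_mul, abs_sgn, one_mul, abs_of_nonneg (by linarith [hmono s])]
  have htel : ∀ K, ∑ s ∈ range K, |partEntry M β (s + 1) a| = trunc (lvl M β K) |a| - trunc (lvl M β 0) |a| := by
    intro K
    induction K with
    | zero => simp
    | succ K ih => rw [sum_range_succ, ih, habs]; ring
  rw [htel, trunc_lvl_zero M β ha, remEntry_eq M β k ha, abs_mul, abs_sgn, one_mul,
    abs_of_nonneg (sub_trunc_bounds _ _).1]
  ring

/-- Consequently `Σ_{s=1}^{k}|(A_s)ᵢₗ| ≤ |aᵢₗ|` for every `k` (the inequality used from (21) in (22)).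
[cite: UchinoOzakiImamura2025, §5.1 eqs. (21)–(22)] -/
theorem sum_abs_partEntry_le (M : ℤ) (β k : ℕ) {a : ℚ} (ha : |a| < (2 : ℚ) ^ (M + 1)) :
    ∑ s ∈ range k, |partEntry M β (s + 1) a| ≤ |a| := by
  have := sum_abs_partEntry_add_abs_rem M β k ha
  linarith [abs_nonneg (remEntry M β k a)]

/-- TERMINATION ("the loop terminates when `A = O` in practice"): a number on the grid `2^{E}ℤ` (a float
with `ulp ≥ 2^E`) is exhausted by the slices reaching level `E`: `e_k ≤ E ⟹ V_k = 0`.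
[cite: UchinoOzakiImamura2025, §2 (remark on Algorithm 1's loop) and eq. (5)] -/
theorem remEntry_eq_zero_of_onGrid (M : ℤ) (β k : ℕ) {a : ℚ} (ha : |a| < (2 : ℚ) ^ (M + 1)) {E : ℤ}
    (hg : OnGrid ((2 : ℚ) ^ E) a) (hk : lvl M β k ≤ E) : remEntry M β k a = 0 := by
  rw [remEntry_eq M β k ha]
  suffices trunc (lvl M β k) |a| = |a| by rw [this]; ring
  obtain ⟨z, hz⟩ := hg
  obtain ⟨d, hd⟩ := Int.eq_ofNat_of_zero_le (sub_nonneg.mpr hk)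
  have hE : (2 : ℚ) ^ E = (2 : ℚ) ^ (d : ℕ) * (2 : ℚ) ^ lvl M β k := by
    rw [← zpow_natCast, ← zpow_add₀ (by norm_num : (2 : ℚ) ≠ 0)]; congr 1; omega
  have habs : |a| = ((|z| * 2 ^ d : ℤ) : ℚ) * (2 : ℚ) ^ lvl M β k := by
    rw [hz, abs_mul, abs_of_pos (two_zpow_pos E), hE]; push_cast; ring
  unfold trunc
  rw [habs, mul_div_assoc, div_self (two_zpow_pos _).ne', mul_one, Int.floor_intCast]

/-- The paper's row scale works: with `μ''ᵢ = 2^{Mᵢ}`, `Mᵢ = ⌊log₂ maxₗ|aᵢₗ|⌋`, every entry of the row has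
`|aᵢₗ| < 2^{Mᵢ+1}` (all that the slicing needs). [cite: UchinoOzakiImamura2025, §2 Algorithm 3 (line 2)] -/
theorem abs_lt_two_zpow_log_succ {x m : ℚ} (hx : |x| ≤ m) : |x| < (2 : ℚ) ^ (Int.log 2 m + 1) :=
  lt_of_le_of_lt hx (by exact_mod_cast Int.lt_zpow_succ_log_self (by norm_num : 1 < 2) m)

/-! ### §2 eq. (5)–(6) for matrices: `A = diag(μ'')Σₛ2^{1−βs}A''ₛ + V_k`, `B = Σₜ2^{1−βt}B''ₜ diag(ν'') + W_k` -/

section MatrixSlices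

variable {m n q : ℕ}

/-- The integer slice matrix `A''ₛ ∈ 𝕀₈^{m×n}` (row scales `2^{Mᵢ}`). [cite: UchinoOzakiImamura2025, §2 eq. (5)] -/
def intSliceM (A : Matrix (Fin m) (Fin n) ℚ) (M : Fin m → ℤ) (β s : ℕ) : Matrix (Fin m) (Fin n) ℤ :=
  Matrix.of fun i l => sliceInt (M i) β s (A i l)

/-- The floating-point slice `Aₛ = diag(μ'')2^{−βs+1}A''ₛ`, row-scaled. [cite: UchinoOzakiImamura2025, §2 eq. (5) and §5 (definition of Aᵢ)] -/
def sliceM (A : Matrix (Fin m) (Fin n) ℚ) (M : Fin m → ℤ) (β s : ℕ) : Matrix (Fin m) (Fin n) ℚ :=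
  Matrix.of fun i l => partEntry (M i) β s (A i l)

/-- The floating-point slice `Bₜ = 2^{−βt+1}B''ₜ diag(ν'')`, column-scaled (= the row slicing of `Bᵀ`).
[cite: UchinoOzakiImamura2025, §2 eq. (6) and §5 (definition of Bᵢ)] -/
def sliceMc (B : Matrix (Fin n) (Fin q) ℚ) (N : Fin q → ℤ) (β t : ℕ) : Matrix (Fin n) (Fin q) ℚ :=
  Matrix.of fun l j => partEntry (N j) β t (B l j)

/-- The truncation remainder `V_k` of (1)/(5) as a matrix. [cite: UchinoOzakiImamura2025, §2 eqs. (1), (5)] -/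
def remSliceM (A : Matrix (Fin m) (Fin n) ℚ) (M : Fin m → ℤ) (β k : ℕ) : Matrix (Fin m) (Fin n) ℚ :=
  Matrix.of fun i l => remEntry (M i) β k (A i l)

/-- `Aₛ = diag(μ'')·2^{−βs+1}·A''ₛ` literally (`μ''ᵢ = 2^{Mᵢ}`). [cite: UchinoOzakiImamura2025, §2 eq. (5)] -/
theorem sliceM_eq (A : Matrix (Fin m) (Fin n) ℚ) (M : Fin m → ℤ) (β s : ℕ) :
    sliceM A M β s = Matrix.diagonal (fun i => (2 : ℚ) ^ M i) *
      ((2 : ℚ) ^ (1 - (β * s : ℕ) : ℤ) • (intSliceM A M β s).map (fun z : ℤ => (z : ℚ))) := by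
  ext i l
  simp only [sliceM, intSliceM, Matrix.of_apply, Matrix.diagonal_mul, Matrix.smul_apply, Matrix.map_apply,
    smul_eq_mul, partEntry, lvl]
  rw [show (M i + 1 - (β * s : ℕ) : ℤ) = M i + (1 - (β * s : ℕ) : ℤ) by ring, zpow_add₀ (by norm_num : (2 : ℚ) ≠ 0)]
  ring

/-- EQ. (5): `A = diag(μ'')(2^{−β+1}A''₁ + ⋯ + 2^{−kβ+1}A''ₖ) + V_k` — i.e. `A = Σ_{s=1}^{k} Aₛ + V_k`.
[cite: UchinoOzakiImamura2025, §2 eq. (5)] -/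
theorem eq_sum_sliceM_add_rem (A : Matrix (Fin m) (Fin n) ℚ) (M : Fin m → ℤ) (β k : ℕ) :
    A = (∑ s ∈ range k, sliceM A M β (s + 1)) + remSliceM A M β k := by
  ext i l
  rw [Matrix.add_apply, Matrix.sum_apply]
  simp only [sliceM, remSliceM, Matrix.of_apply]
  exact eq_sum_partEntry_add_rem (M i) β k (A i l)

/-- `V_k = A − Σ_{s≤k} Aₛ` entrywise (eq. (1)). [cite: UchinoOzakiImamura2025, §2 eq. (1)] -/
theorem sub_sum_sliceM_apply (A : Matrix (Fin m) (Fin n) ℚ) (M : Fin m → ℤ) (β k : ℕ) (i : Fin m) (l : Fin n) :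
    (A - ∑ s ∈ range k, sliceM A M β (s + 1)) i l = remEntry (M i) β k (A i l) := by
  rw [Matrix.sub_apply, Matrix.sum_apply]
  simp only [sliceM, Matrix.of_apply, remEntry]

/-- `W_k = B − Σ_{t≤k} Bₜ` entrywise (eq. (1)). [cite: UchinoOzakiImamura2025, §2 eq. (1)] -/
theorem sub_sum_sliceMc_apply (B : Matrix (Fin n) (Fin q) ℚ) (N : Fin q → ℤ) (β k : ℕ) (l : Fin n) (j : Fin q) :
    (B - ∑ t ∈ range k, sliceMc B N β (t + 1)) l j = remEntry (N j) β k (B l j) := by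
  rw [Matrix.sub_apply, Matrix.sum_apply]
  simp only [sliceMc, Matrix.of_apply, remEntry]

end MatrixSlices

/-! ### §2 / §5.2: the slice products are exact INT32 computations (no overflow) -/

/-- ONE ENTRY OF A SLICE PRODUCT: `|(A''ₛB''ₜ)ᵢⱼ| ≤ Σₗ|(A''ₛ)ᵢₗ||(B''ₜ)ₗⱼ| ≤ n(2^β − 1)²`, and the same for
every PARTIAL sum of its `n` products (any subset — any accumulation order inside the tensor core).
[cite: UchinoOzakiImamura2025, §5.2 (display after eq. (32))] -/
theorem abs_partial_dot_le {n β : ℕ} (x y : Fin n → ℤ) (hx : ∀ l, |x l| ≤ (2 : ℤ) ^ β - 1)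
    (hy : ∀ l, |y l| ≤ (2 : ℤ) ^ β - 1) (S : Finset (Fin n)) :
    |∑ l ∈ S, x l * y l| ≤ (n : ℤ) * ((2 : ℤ) ^ β - 1) ^ 2 := by
  have h1 : (0 : ℤ) ≤ (2 : ℤ) ^ β - 1 := by
    have : (1 : ℤ) ≤ 2 ^ β := one_le_pow₀ (by norm_num); linarith
  calc |∑ l ∈ S, x l * y l| ≤ ∑ l ∈ S, |x l * y l| := abs_sum_le_sum_abs _ _
    _ ≤ ∑ _l ∈ S, ((2 : ℤ) ^ β - 1) ^ 2 := sum_le_sum fun l _ => by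
        rw [abs_mul, sq]; exact mul_le_mul (hx l) (hy l) (abs_nonneg _) h1
    _ = (S.card : ℤ) * ((2 : ℤ) ^ β - 1) ^ 2 := by rw [sum_const, nsmul_eq_mul]
    _ ≤ (n : ℤ) * ((2 : ℤ) ^ β - 1) ^ 2 := by
        refine mul_le_mul_of_nonneg_right ?_ (sq_nonneg _)
        exact_mod_cast (card_le_univ S).trans (by simp)

/-- THE ARITHMETIC OF (4) AND (12): `N·2^{2β} ≤ 2^31 ⟹ N·(2^β − 1)² ≤ 2^31 − 1` (`β ≥ 1`; used with
`N = n` for one slice product and `N = r·n` for a group of `r`: "`(s−1)n(2^β−1)² < 2^31 − 1` for `β ≥ 1`").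
[cite: UchinoOzakiImamura2025, §5.2 (derivation after eq. (32))] -/
theorem mul_sq_pred_le {N β : ℕ} (hβ : 1 ≤ β) (hN : N * 2 ^ (2 * β) ≤ 2 ^ 31) :
    (N : ℤ) * ((2 : ℤ) ^ β - 1) ^ 2 ≤ 2 ^ 31 - 1 := by
  rcases Nat.eq_zero_or_pos N with rfl | hNpos
  · norm_num
  have hN' : (N : ℤ) * (2 : ℤ) ^ (2 * β) ≤ 2 ^ 31 := by exact_mod_cast hN
  have h2 : (2 : ℤ) ≤ (2 : ℤ) ^ β := by
    calc (2 : ℤ) = 2 ^ 1 := by norm_num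
      _ ≤ 2 ^ β := pow_le_pow_right₀ (by norm_num) hβ
  have hsq : ((2 : ℤ) ^ β - 1) ^ 2 ≤ (2 : ℤ) ^ (2 * β) - 1 := by
    rw [show (2 : ℤ) ^ (2 * β) = ((2 : ℤ) ^ β) ^ 2 by rw [mul_comm, pow_mul]]; nlinarith
  have hN1 : (1 : ℤ) ≤ N := by exact_mod_cast hNpos
  calc (N : ℤ) * ((2 : ℤ) ^ β - 1) ^ 2 ≤ (N : ℤ) * ((2 : ℤ) ^ (2 * β) - 1) :=
        mul_le_mul_of_nonneg_left hsq (by positivity)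
    _ = (N : ℤ) * (2 : ℤ) ^ (2 * β) - N := by ring
    _ ≤ 2 ^ 31 - 1 := by linarith

/-- "There is no error in `A''ₛB''ₜ` … on the INT8 Tensor Core barring overflow" — and under (4) there
is none: with `β = beta n ≥ 1` every partial sum of every entry of a slice product lies in `𝕀₃₂`.
[cite: UchinoOzakiImamura2025, §2 (after eq. (6)) with eq. (4)] -/
theorem inInt32_partial_dot {n : ℕ} (hn : n ≤ 2 ^ 29) (x y : Fin n → ℤ)
    (hx : ∀ l, |x l| ≤ (2 : ℤ) ^ beta n - 1) (hy : ∀ l, |y l| ≤ (2 : ℤ) ^ beta n - 1) (S : Finset (Fin n)) :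
    InInt 32 (∑ l ∈ S, x l * y l) := by
  refine inInt_of_abs_le (le_trans (abs_partial_dot_le x y hx hy S) ?_)
  have h := mul_sq_pred_le ((one_le_beta_iff n).mpr hn) (N := n) (by simpa using mul_two_pow_two_mul_beta_le hn)
  simpa using h

/-- EQ. (12): `r := max(1, 2^{31 − 2β − ⌈log₂ n⌉})`, the number of slice products of one group that may
share an INT32 accumulator. [cite: UchinoOzakiImamura2025, §3.2 eq. (12)] -/
def rConst (β n : ℕ) : ℕ := max 1 (2 ^ (31 - 2 * β - Nat.clog 2 n))

/-- `r ≥ 1`. [cite: UchinoOzakiImamura2025, §3.2 eq. (12)] -/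
theorem one_le_rConst (β n : ℕ) : 1 ≤ rConst β n := le_max_left _ _

/-- Under (4) (`2β + ⌈log₂ n⌉ ≤ 31`), `r = 2^{31−2β−⌈log₂n⌉}` and `r·n·2^{2β} ≤ 2^31`.
[cite: UchinoOzakiImamura2025, §3.2 eq. (12) and §5.2 (derivation after eq. (32))] -/
theorem rConst_mul_le {β n : ℕ} (h : 2 * β + Nat.clog 2 n ≤ 31) : rConst β n * n * 2 ^ (2 * β) ≤ 2 ^ 31 := by
  have hr : rConst β n = 2 ^ (31 - 2 * β - Nat.clog 2 n) := by
    unfold rConst; exact max_eq_right (Nat.one_le_two_pow)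
  rw [hr]
  calc 2 ^ (31 - 2 * β - Nat.clog 2 n) * n * 2 ^ (2 * β)
      ≤ 2 ^ (31 - 2 * β - Nat.clog 2 n) * 2 ^ Nat.clog 2 n * 2 ^ (2 * β) :=
        Nat.mul_le_mul_right _ (Nat.mul_le_mul_left _ (le_two_pow_clog n))
    _ = 2 ^ ((31 - 2 * β - Nat.clog 2 n) + Nat.clog 2 n + 2 * β) := by rw [pow_add, pow_add]
    _ = 2 ^ 31 := by congr 1; omega

/-- EQS. (31)–(32), GROUP-WISE ERROR-FREE ACCUMULATION: the products of `q ≤ r` slice pairs — `q·n`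
integers of modulus `≤ (2^β − 1)²` — and all their partial sums (any sub-collection, so any order of
accumulation on the unit) stay in `𝕀₃₂`: "the summation `Σ_{s=1}^{min(r,g−1)} A''_{i_s}B''_{j_s}` can be
computed without error on the INT8 Tensor Core". [cite: UchinoOzakiImamura2025, §3.2 and §5.2 eqs. (31)–(32)] -/
theorem inInt32_group_sum {β n : ℕ} (hβ : 1 ≤ β) (h : 2 * β + Nat.clog 2 n ≤ 31) (L : List ℤ)
    (hL : ∀ z ∈ L, |z| ≤ ((2 : ℤ) ^ β - 1) ^ 2) (hlen : L.length ≤ rConst β n * n) :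
    |L.sum| ≤ 2 ^ 31 - 1 ∧ InInt 32 L.sum := by
  have h1 : |L.sum| ≤ (L.length : ℤ) * ((2 : ℤ) ^ β - 1) ^ 2 := by
    induction L with
    | nil => simp
    | cons z L ih =>
        have hz := hL z (by simp)
        have ih' := ih (fun w hw => hL w (by simp [hw])) (by simp at hlen ⊢; omega)
        simp only [List.sum_cons, List.length_cons, Nat.cast_succ]
        calc |z + L.sum| ≤ |z| + |L.sum| := abs_add_le _ _
          _ ≤ _ := by linarith
  have h2 : (L.length : ℤ) * ((2 : ℤ) ^ β - 1) ^ 2 ≤ (rConst β n * n : ℕ) * ((2 : ℤ) ^ β - 1) ^ 2 :=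
    mul_le_mul_of_nonneg_right (by exact_mod_cast hlen) (sq_nonneg _)
  have h3 := mul_sq_pred_le hβ (N := rConst β n * n) (rConst_mul_le h)
  have h4 : |L.sum| ≤ 2 ^ 31 - 1 := h1.trans (h2.trans h3)
  exact ⟨h4, inInt_of_abs_le (by simpa using h4)⟩

/-- TWO'S-COMPLEMENT INT32: the value an `𝕀₃₂` register holds after a wrapping addition.
[cite: UchinoOzakiImamura2025, §2 ("no error occurs in integer arithmetic, barring overflow")] -/
def wrap32 (z : ℤ) : ℤ := (z + 2 ^ 31) % 2 ^ 32 - 2 ^ 31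

/-- In range, wrapping is the identity. [cite: UchinoOzakiImamura2025, §2 (𝕀₃₂)] -/
theorem wrap32_eq_self {z : ℤ} (h : InInt 32 z) : wrap32 z = z := by
  obtain ⟨h1, h2⟩ := h
  unfold wrap32
  norm_num at h1 h2 ⊢
  omega

/-- An accumulation order of integer products on the unit: leaves = products (exact), nodes = one
register addition each. [cite: UchinoOzakiImamura2025, §3.2 (accumulation on the INT8 Tensor Core)] -/
inductive AccTree
  | leaf : ℤ → AccTree
  | node : AccTree → AccTree → AccTree

namespace AccTree

/-- The exact sum. [cite: UchinoOzakiImamura2025, §3.2] -/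
def exact : AccTree → ℤ
  | leaf z => z
  | node l r => exact l + exact r

/-- The INT32 register value: every addition wraps. [cite: UchinoOzakiImamura2025, §3.2] -/
def evalWrap : AccTree → ℤ
  | leaf z => z
  | node l r => wrap32 (evalWrap l + evalWrap r)

/-- Every partial sum formed along the way is in `𝕀₃₂`. [cite: UchinoOzakiImamura2025, §5.2 eq. (32)] -/
def NoOverflow : AccTree → Prop
  | leaf z => InInt 32 z
  | node l r => NoOverflow l ∧ NoOverflow r ∧ InInt 32 (exact l + exact r)

/-- "NO ERROR OCCURS IN INTEGER ARITHMETIC, BARRING OVERFLOW": if no partial sum leaves `𝕀₃₂`, the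
register holds the exact sum, whatever the order. [cite: UchinoOzakiImamura2025, §2 and §5.2 eq. (32)] -/
theorem evalWrap_eq_exact : ∀ t : AccTree, t.NoOverflow → t.evalWrap = t.exact
  | leaf _, _ => rfl
  | node l r, ⟨hl, hr, h⟩ => by
      simp only [evalWrap, exact]
      rw [evalWrap_eq_exact l hl, evalWrap_eq_exact r hr, wrap32_eq_self h]

end AccTree

/-! ### §3.2 eq. (11): one scaling per group -/

/-- EQ. (11): inside a group `i_v + j_v = g` all terms carry the same power of two, so
`Σ_v diag(μ'')2^{1−βi_v}2^{1−βj_v}A''_{i_v}B''_{j_v}diag(ν'') = 2^{2−βg}·diag(μ'')(Σ_v A''_{i_v}B''_{j_v})diag(ν'')`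
— one conversion, one scaling and one FP64 addition per group instead of per product.
[cite: UchinoOzakiImamura2025, §3.2 eq. (11)] -/
theorem group_factorisation {m n q : ℕ} {ι : Type*} (V : Finset ι) (iv jv : ι → ℕ) (g β : ℕ)
    (hg : ∀ v ∈ V, iv v + jv v = g) (μ : Fin m → ℚ) (ν : Fin q → ℚ)
    (X : ι → Matrix (Fin m) (Fin n) ℚ) (Y : ι → Matrix (Fin n) (Fin q) ℚ) :
    ∑ v ∈ V, ((2 : ℚ) ^ (1 - (β * iv v : ℤ)) * (2 : ℚ) ^ (1 - (β * jv v : ℤ))) •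
        (Matrix.diagonal μ * (X v * Y v) * Matrix.diagonal ν)
      = (2 : ℚ) ^ (2 - (β * g : ℤ)) • (Matrix.diagonal μ * (∑ v ∈ V, X v * Y v) * Matrix.diagonal ν) := by
  have hc : ∀ v ∈ V, (2 : ℚ) ^ (1 - (β * iv v : ℤ)) * (2 : ℚ) ^ (1 - (β * jv v : ℤ)) = (2 : ℚ) ^ (2 - (β * g : ℤ)) := by
    intro v hv
    rw [← zpow_add₀ (by norm_num : (2 : ℚ) ≠ 0)]
    congr 1
    have := hg v hv
    zify at this
    linear_combination (-(β : ℤ)) * this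
  rw [Matrix.mul_sum, Matrix.sum_mul, smul_sum]
  exact sum_congr rfl fun v hv => by rw [hc v hv]

/-! ### §5.1: truncation error of the `k`-slice scheme, eqs. (16)–(18) -/

section Truncation

variable {m n q : ℕ}

/-- THE TRUNCATION IDENTITY (display before (18)): with `V_w := A − Σ_{s≤w}A_s`, `W_w := B − Σ_{t≤w}B_t` (1),
`AB − Σ_{i=1}^{k}Σ_{j=1}^{k−i+1} AᵢBⱼ = Σ_{i=1}^{k} AᵢW_{k−i+1} + V_kB` (0-based sums: `As (s+1) = A_{s+1}`).
[cite: UchinoOzakiImamura2025, §5.1 (display before eq. (18)) and eq. (1)] -/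
theorem truncation_identity (A : Matrix (Fin m) (Fin n) ℚ) (B : Matrix (Fin n) (Fin q) ℚ)
    (As : ℕ → Matrix (Fin m) (Fin n) ℚ) (Bs : ℕ → Matrix (Fin n) (Fin q) ℚ) (k : ℕ) :
    A * B - ∑ i ∈ range k, ∑ j ∈ range (k - i), As (i + 1) * Bs (j + 1)
      = (∑ i ∈ range k, As (i + 1) * (B - ∑ t ∈ range (k - i), Bs (t + 1)))
        + (A - ∑ s ∈ range k, As (s + 1)) * B := by
  have h := mul_expansion (fun i => As (i + 1)) (fun w => A - ∑ s ∈ range w, As (s + 1))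
    (fun j => Bs (j + 1)) (fun w => B - ∑ t ∈ range w, Bs (t + 1))
    (fun w => by simp [sum_range_succ]; abel) (fun w => by simp [sum_range_succ]; abel) k
  simp only [sum_range_zero, sub_zero] at h
  rw [h]; abel

/-- EQ. (18), THE TRUNCATION BOUND, entrywise: if `|V_k| ≤ 2^{1−βk}g eᵀ`, `|W_w| ≤ 2^{1−βw}e fᵀ` (16),
`|Aᵢ| ≤ 2^{1−β(i−1)}g eᵀ`, `|B| ≤ 2e fᵀ` (17), then
`|AB − Σᵢ Σ_{j≤k−i+1} AᵢBⱼ| ≤ Σᵢ|Aᵢ||W_{k−i+1}| + |V_k||B| ≤ 4(k+1)n2^{−βk}·g fᵀ` (`gᵢ = 2^{Mᵢ}`, `fⱼ = 2^{Nⱼ}`).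
Valid for the bit-mask slicing (by `abs_remEntry_lt`, `abs_partEntry_le`) and, as the paper notes, for
the round-to-nearest slicings alike. [cite: UchinoOzakiImamura2025, §5.1 eqs. (16)–(18)] -/
theorem truncation_bound (A : Matrix (Fin m) (Fin n) ℚ) (B : Matrix (Fin n) (Fin q) ℚ)
    (As : ℕ → Matrix (Fin m) (Fin n) ℚ) (Bs : ℕ → Matrix (Fin n) (Fin q) ℚ) (k β : ℕ)
    (M : Fin m → ℤ) (N : Fin q → ℤ)
    (hV : ∀ i l, |(A - ∑ s ∈ range k, As (s + 1)) i l| ≤ (2 : ℚ) ^ (1 - (β * k : ℤ)) * (2 : ℚ) ^ M i)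
    (hW : ∀ w ≤ k, 1 ≤ w → ∀ l j, |(B - ∑ t ∈ range w, Bs (t + 1)) l j| ≤ (2 : ℚ) ^ (1 - (β * w : ℤ)) * (2 : ℚ) ^ N j)
    (hAs : ∀ i < k, ∀ r l, |As (i + 1) r l| ≤ (2 : ℚ) ^ (1 - (β * i : ℤ)) * (2 : ℚ) ^ M r)
    (hB : ∀ l j, |B l j| ≤ 2 * (2 : ℚ) ^ N j) (i : Fin m) (j : Fin q) :
    |(A * B - ∑ i ∈ range k, ∑ j ∈ range (k - i), As (i + 1) * Bs (j + 1)) i j|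
      ≤ 4 * (k + 1) * n * (2 : ℚ) ^ (-(β * k : ℤ)) * (2 : ℚ) ^ M i * (2 : ℚ) ^ N j := by
  rw [truncation_identity]
  have h2 : (0 : ℚ) < 2 := by norm_num
  set G := (2 : ℚ) ^ M i
  set F := (2 : ℚ) ^ N j
  have hG : 0 < G := two_zpow_pos _
  have hF : 0 < F := two_zpow_pos _
  have hK : (2 : ℚ) ^ (-(β * k : ℤ)) > 0 := two_zpow_pos _
  -- the `k` cross terms `AᵢW_{k−i+1}`
  have hcross : ∀ s ∈ range k, |(As (s + 1) * (B - ∑ t ∈ range (k - s), Bs (t + 1))) i j|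
      ≤ (n : ℚ) * (4 * (2 : ℚ) ^ (-(β * k : ℤ)) * G * F) := by
    intro s hs
    rw [mem_range] at hs
    rw [Matrix.mul_apply]
    calc |∑ l, As (s + 1) i l * (B - ∑ t ∈ range (k - s), Bs (t + 1)) l j|
        ≤ ∑ l, |As (s + 1) i l * (B - ∑ t ∈ range (k - s), Bs (t + 1)) l j| := abs_sum_le_sum_abs _ _
      _ ≤ ∑ _l : Fin n, 4 * (2 : ℚ) ^ (-(β * k : ℤ)) * G * F := sum_le_sum fun l _ => by
          rw [abs_mul]
          have ha := hAs s hs i l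
          have hw := hW (k - s) (by omega) (by omega) l j
          calc |As (s + 1) i l| * |(B - ∑ t ∈ range (k - s), Bs (t + 1)) l j|
              ≤ ((2 : ℚ) ^ (1 - (β * s : ℤ)) * G) * ((2 : ℚ) ^ (1 - (β * (k - s : ℕ) : ℤ)) * F) :=
                mul_le_mul ha hw (abs_nonneg _) (by positivity)
            _ = 4 * (2 : ℚ) ^ (-(β * k : ℤ)) * G * F := by
                have : (2 : ℚ) ^ (1 - (β * s : ℤ)) * (2 : ℚ) ^ (1 - (β * (k - s : ℕ) : ℤ))
                    = 4 * (2 : ℚ) ^ (-(β * k : ℤ)) := by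
                  rw [← zpow_add₀ h2.ne', show (4 : ℚ) = (2 : ℚ) ^ (2 : ℤ) by norm_num, ← zpow_add₀ h2.ne']
                  congr 1; push_cast [Nat.cast_sub hs.le]; ring
                calc _ = ((2 : ℚ) ^ (1 - (β * s : ℤ)) * (2 : ℚ) ^ (1 - (β * (k - s : ℕ) : ℤ))) * G * F := by ring
                  _ = _ := by rw [this]
      _ = (n : ℚ) * (4 * (2 : ℚ) ^ (-(β * k : ℤ)) * G * F) := by
          rw [sum_const, card_univ, Fintype.card_fin, nsmul_eq_mul]
  -- the term `V_k B`
  have hlast : |((A - ∑ s ∈ range k, As (s + 1)) * B) i j| ≤ (n : ℚ) * (4 * (2 : ℚ) ^ (-(β * k : ℤ)) * G * F) := by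
    rw [Matrix.mul_apply]
    calc |∑ l, (A - ∑ s ∈ range k, As (s + 1)) i l * B l j|
        ≤ ∑ l, |(A - ∑ s ∈ range k, As (s + 1)) i l * B l j| := abs_sum_le_sum_abs _ _
      _ ≤ ∑ _l : Fin n, 4 * (2 : ℚ) ^ (-(β * k : ℤ)) * G * F := sum_le_sum fun l _ => by
          rw [abs_mul]
          calc |(A - ∑ s ∈ range k, As (s + 1)) i l| * |B l j|
              ≤ ((2 : ℚ) ^ (1 - (β * k : ℤ)) * G) * (2 * F) :=
                mul_le_mul (hV i l) (hB l j) (abs_nonneg _) (by positivity)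
            _ = 4 * (2 : ℚ) ^ (-(β * k : ℤ)) * G * F := by
                rw [show (1 - (β * k : ℤ)) = (-(β * k : ℤ)) + 1 by ring, zpow_add₀ h2.ne', zpow_one]; ring
      _ = (n : ℚ) * (4 * (2 : ℚ) ^ (-(β * k : ℤ)) * G * F) := by
          rw [sum_const, card_univ, Fintype.card_fin, nsmul_eq_mul]
  rw [Matrix.add_apply]
  calc |(∑ s ∈ range k, As (s + 1) * (B - ∑ t ∈ range (k - s), Bs (t + 1))) i j
          + ((A - ∑ s ∈ range k, As (s + 1)) * B) i j|
      ≤ |(∑ s ∈ range k, As (s + 1) * (B - ∑ t ∈ range (k - s), Bs (t + 1))) i j|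
          + |((A - ∑ s ∈ range k, As (s + 1)) * B) i j| := abs_add_le _ _
    _ ≤ (k : ℚ) * ((n : ℚ) * (4 * (2 : ℚ) ^ (-(β * k : ℤ)) * G * F))
          + (n : ℚ) * (4 * (2 : ℚ) ^ (-(β * k : ℤ)) * G * F) := by
        refine add_le_add ?_ hlast
        rw [Matrix.sum_apply]
        calc |∑ s ∈ range k, (As (s + 1) * (B - ∑ t ∈ range (k - s), Bs (t + 1))) i j|
            ≤ ∑ s ∈ range k, |(As (s + 1) * (B - ∑ t ∈ range (k - s), Bs (t + 1))) i j| :=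
              abs_sum_le_sum_abs _ _
          _ ≤ ∑ _s ∈ range k, (n : ℚ) * (4 * (2 : ℚ) ^ (-(β * k : ℤ)) * G * F) := sum_le_sum hcross
          _ = _ := by rw [sum_const, card_range, nsmul_eq_mul]
    _ = 4 * (k + 1) * n * (2 : ℚ) ^ (-(β * k : ℤ)) * G * F := by ring

/-- The hypotheses of `truncation_bound` hold for the bit-mask slicing (16)–(17): `V_k`, each `W_w`,
each `A_s`, and `|B| < 2e fᵀ`. [cite: UchinoOzakiImamura2025, §5.1 eqs. (16)–(17) (Figure 7)] -/
theorem bitmask_hypotheses (M : ℤ) (β : ℕ) {a : ℚ} (ha : |a| < (2 : ℚ) ^ (M + 1)) (k s : ℕ) :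
    |remEntry M β k a| ≤ (2 : ℚ) ^ (1 - (β * k : ℤ)) * (2 : ℚ) ^ M ∧
      |partEntry M β (s + 1) a| ≤ (2 : ℚ) ^ (1 - (β * s : ℤ)) * (2 : ℚ) ^ M ∧ |a| ≤ 2 * (2 : ℚ) ^ M := by
  have hl : ∀ t : ℕ, (2 : ℚ) ^ lvl M β t = (2 : ℚ) ^ (1 - (β * t : ℤ)) * (2 : ℚ) ^ M := by
    intro t; unfold lvl; rw [← zpow_add₀ (by norm_num : (2 : ℚ) ≠ 0)]; congr 1; push_cast; ring
  refine ⟨?_, ?_, ?_⟩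
  · rw [← hl]; exact (abs_remEntry_lt M β k ha).le
  · rw [← hl]; exact (abs_partEntry_le M β s a).2.le
  · rw [zpow_add₀ (by norm_num : (2 : ℚ) ≠ 0), zpow_one] at ha; linarith

/-- EQ. (18) FOR THE BIT-MASK SCHEME ITSELF (Algorithms 3–4/5): with row scales `2^{Mᵢ} > |aᵢₗ|/2` and
column scales `2^{Nⱼ} > |bₗⱼ|/2`,
`|AB − Σᵢ Σ_{j≤k−i+1} AᵢBⱼ|ᵢⱼ ≤ 4(k+1)n·2^{−βk}·2^{Mᵢ}2^{Nⱼ}`. [cite: UchinoOzakiImamura2025, §5.1 eq. (18)] -/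
theorem truncation_bound_bitmask (A : Matrix (Fin m) (Fin n) ℚ) (B : Matrix (Fin n) (Fin q) ℚ)
    (M : Fin m → ℤ) (N : Fin q → ℤ) (hA : ∀ i l, |A i l| < (2 : ℚ) ^ (M i + 1))
    (hB : ∀ l j, |B l j| < (2 : ℚ) ^ (N j + 1)) (k β : ℕ) (i : Fin m) (j : Fin q) :
    |(A * B - ∑ s ∈ range k, ∑ t ∈ range (k - s), sliceM A M β (s + 1) * sliceMc B N β (t + 1)) i j|
      ≤ 4 * (k + 1) * n * (2 : ℚ) ^ (-(β * k : ℤ)) * (2 : ℚ) ^ M i * (2 : ℚ) ^ N j := by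
  refine truncation_bound A B (sliceM A M β) (sliceMc B N β) k β M N ?_ ?_ ?_ ?_ i j
  · intro i l; rw [sub_sum_sliceM_apply]; exact (bitmask_hypotheses (M i) β (hA i l) k 0).1
  · intro w _ _ l j; rw [sub_sum_sliceMc_apply]; exact (bitmask_hypotheses (N j) β (hB l j) w 0).1
  · intro s _ r l; simp only [sliceM, Matrix.of_apply]; exact (bitmask_hypotheses (M r) β (hA r l) 0 s).2.1
  · intro l j; exact (bitmask_hypotheses (N j) β (hB l j) 0 0).2.2

end Truncation

/-! ### §5.1: the FP64 accumulation — eqs. (14), (21)–(22) in any order -/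

section Accumulation

variable {m n q : ℕ}

/-- INT32 → FP64 conversion and the scaling by `2^{2−βg}μ''ᵢν''ⱼ` are exact: an integer `C''ᵢⱼ` with
`|C''ᵢⱼ| ≤ 2^31 − 1 < 2^p` times a power of two `2^E ≥ 2^{emin}` is a floating-point number (the summands
of Algorithms 4–5, "`C ← C + 2^{−βg+2}diag(μ'')FP64(C'')diag(ν'')`", are exact).
[cite: UchinoOzakiImamura2025, §2 Algorithm 4 (line 8), §3.2 Algorithm 5 (line 13) and §5 ("we can
obtain the exact product AᵢBⱼ … by using GEMM in the INT8 Tensor Core and scaling by powers of two")] -/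
theorem isFloat_int_mul_two_zpow (hp : 31 ≤ p) {z : ℤ} (hz : |z| ≤ 2 ^ 31 - 1) {E : ℤ} (hE : emin ≤ E) :
    IsFloat p emin ((z : ℚ) * (2 : ℚ) ^ E) := by
  refine isFloat_of_int_mul z E ?_ hE
  have : (2 : ℤ) ^ 31 ≤ 2 ^ p := pow_le_pow_right₀ (by norm_num) hp
  omega

/-- EQ. (14) APPLIED, = (22) first line: the FP64 accumulation `T_k` of the `½k(k+1)` exactly computed
terms (floats) in ANY order satisfies `|Σ AᵢBⱼ − T_k| ≤ (½k(k+1) − 1)u·Σ|AᵢBⱼ|` entrywise — here for an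
arbitrary list of exact terms (leaves) and evaluation order. [cite: UchinoOzakiImamura2025, §5.1 eqs. (14), (22)] -/
theorem accumulation_bound (hp : 2 ≤ p) (hfl : IsRoundNearest p emin fl) (T : SumTree)
    (hT : ∀ x ∈ T.leaves, IsFloat p emin x) :
    |T.exact - T.eval fl| ≤ ((T.leaves.length : ℚ) - 1) * unitRoundoff p * (T.leaves.map abs).sum := by
  rw [abs_sub_comm]; exact proposition31 hp hfl T hT

/-- EQ. (21) ⟹ `Σᵢ Σ_{j≤k−i+1} |AᵢBⱼ| ≤ (Σᵢ|Aᵢ|)(Σⱼ|Bⱼ|) ≤ |A||B|` entrywise: the second line of (22).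
Hypotheses: sign-coherent slicings, `Σ_{s≤k}|(A_s)ᵢₗ| ≤ |aᵢₗ|` and `Σ_{t≤k}|(B_t)ₗⱼ| ≤ |bₗⱼ|`
(`sum_abs_partEntry_le`). [cite: UchinoOzakiImamura2025, §5.1 eqs. (21)–(22)] -/
theorem sum_abs_terms_le (A : Matrix (Fin m) (Fin n) ℚ) (B : Matrix (Fin n) (Fin q) ℚ)
    (As : ℕ → Matrix (Fin m) (Fin n) ℚ) (Bs : ℕ → Matrix (Fin n) (Fin q) ℚ) (k : ℕ)
    (hA : ∀ i l, ∑ s ∈ range k, |As (s + 1) i l| ≤ |A i l|)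
    (hB : ∀ l j, ∑ t ∈ range k, |Bs (t + 1) l j| ≤ |B l j|) (i : Fin m) (j : Fin q) :
    ∑ s ∈ range k, ∑ t ∈ range (k - s), |(As (s + 1) * Bs (t + 1)) i j|
      ≤ ∑ l, |A i l| * |B l j| := by
  calc ∑ s ∈ range k, ∑ t ∈ range (k - s), |(As (s + 1) * Bs (t + 1)) i j|
      ≤ ∑ s ∈ range k, ∑ t ∈ range k, |(As (s + 1) * Bs (t + 1)) i j| :=
        sum_le_sum fun s _ => sum_le_sum_of_subset_of_nonneg (range_subset_range.mpr (Nat.sub_le k s))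
          (fun _ _ _ => abs_nonneg _)
    _ ≤ ∑ s ∈ range k, ∑ t ∈ range k, ∑ l, |As (s + 1) i l| * |Bs (t + 1) l j| :=
        sum_le_sum fun s _ => sum_le_sum fun t _ => by
          rw [Matrix.mul_apply]
          exact (abs_sum_le_sum_abs _ _).trans (le_of_eq (sum_congr rfl fun l _ => abs_mul _ _))
    _ = ∑ s ∈ range k, ∑ l, ∑ t ∈ range k, |As (s + 1) i l| * |Bs (t + 1) l j| :=
        sum_congr rfl fun s _ => sum_comm
    _ = ∑ l, ∑ s ∈ range k, ∑ t ∈ range k, |As (s + 1) i l| * |Bs (t + 1) l j| := sum_comm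
    _ = ∑ l, (∑ s ∈ range k, |As (s + 1) i l|) * (∑ t ∈ range k, |Bs (t + 1) l j|) :=
        sum_congr rfl fun l _ => by rw [sum_mul_sum]
    _ ≤ ∑ l, |A i l| * |B l j| := sum_le_sum fun l _ =>
        mul_le_mul (hA i l) (hB l j) (sum_nonneg fun _ _ => abs_nonneg _) (abs_nonneg _)

/-- EQ. (22) ASSEMBLED: for any evaluation order `T` of the `½k(k+1)` exact terms `(AᵢBⱼ)_{ij}` (floats),
`|Σ AᵢBⱼ − T_k|_{ij} ≤ (½k(k+1) − 1)u(|A||B|)_{ij}`. The leaves are given as a list `L` which is a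
permutation of the terms; `(|A||B|)_{ij} = Σₗ|aᵢₗ||bₗⱼ|`. [cite: UchinoOzakiImamura2025, §5.1 eq. (22)] -/
theorem accumulation_bound_AB (hp : 2 ≤ p) (hfl : IsRoundNearest p emin fl)
    (A : Matrix (Fin m) (Fin n) ℚ) (B : Matrix (Fin n) (Fin q) ℚ)
    (As : ℕ → Matrix (Fin m) (Fin n) ℚ) (Bs : ℕ → Matrix (Fin n) (Fin q) ℚ) (k : ℕ)
    (hA : ∀ i l, ∑ s ∈ range k, |As (s + 1) i l| ≤ |A i l|)
    (hB : ∀ l j, ∑ t ∈ range k, |Bs (t + 1) l j| ≤ |B l j|) (i : Fin m) (j : Fin q)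
    (T : SumTree) (hT : ∀ x ∈ T.leaves, IsFloat p emin x)
    (hperm : (T.leaves.map abs).sum ≤ ∑ s ∈ range k, ∑ t ∈ range (k - s), |(As (s + 1) * Bs (t + 1)) i j|) :
    |T.exact - T.eval fl| ≤ ((T.leaves.length : ℚ) - 1) * unitRoundoff p * ∑ l, |A i l| * |B l j| := by
  refine (accumulation_bound hp hfl T hT).trans (mul_le_mul_of_nonneg_left
    (hperm.trans (sum_abs_terms_le A B As Bs k hA hB i j)) (mul_nonneg ?_ (unitRoundoff_pos p).le))
  have := SumTree.one_le_length_leaves T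
  have : (1 : ℚ) ≤ T.leaves.length := by exact_mod_cast this
  linarith

end Accumulation

/-! ### §5.1 eqs. (23)–(29): the leading groups are summed without rounding error -/

section ErrorFree

variable {m n q : ℕ}

/-- EQ. (25): `(A_s)ᵢₗ(B_t)ₗⱼ ∈ 2^{−β(s+t)+2}gᵢfⱼℤ` from (24). [cite: UchinoOzakiImamura2025, §5.1 eqs. (24)–(25)] -/
theorem onGrid_term {β s t : ℕ} {M N : ℤ} {x y : ℚ} (hx : OnGrid ((2 : ℚ) ^ lvl M β s) x)
    (hy : OnGrid ((2 : ℚ) ^ lvl N β t) y) : OnGrid ((2 : ℚ) ^ (lvl M β s + lvl N β t)) (x * y) :=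
  onGrid_mul hx hy

/-- EQ. (26): every term with `s + t ≤ K` lies on the COARSEST grid `2^{e}ℤ` with
`e = M + N + 2 − βK` (`= 2^{−β(k'+1)+2}gᵢfⱼℤ` for `K = k'+1`), hence so does every partial sum of them.
[cite: UchinoOzakiImamura2025, §5.1 eq. (26)] -/
theorem onGrid_term_coarse {β s t K : ℕ} (hst : s + t ≤ K) {M N : ℤ} {x y : ℚ}
    (hx : OnGrid ((2 : ℚ) ^ lvl M β s) x) (hy : OnGrid ((2 : ℚ) ^ lvl N β t) y) :
    OnGrid ((2 : ℚ) ^ (M + N + 2 - (β * K : ℕ))) (x * y) := by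
  refine (onGrid_term hx hy).of_le ?_
  unfold lvl
  have : (β * (s + t) : ℕ) ≤ β * K := Nat.mul_le_mul_left β hst
  zify at this; push_cast at this ⊢; nlinarith

/-- EQ. (27): `|A_sB_t|ᵢⱼ ≤ n·2^{−β(s+t−2)+2}gᵢfⱼ` — per product `|(A_s)ᵢₗ(B_t)ₗⱼ| < 2^{e_{s−1}}2^{e'_{t−1}}`.
[cite: UchinoOzakiImamura2025, §5.1 eq. (27)] -/
theorem abs_term_le {β s t : ℕ} {M N : ℤ} {x y : ℚ} (hx : |x| ≤ (2 : ℚ) ^ lvl M β s)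
    (hy : |y| ≤ (2 : ℚ) ^ lvl N β t) : |x * y| ≤ (2 : ℚ) ^ (lvl M β s + lvl N β t) := by
  rw [abs_mul, zpow_add₀ (by norm_num : (2 : ℚ) ≠ 0)]
  exact mul_le_mul hx hy (abs_nonneg _) (two_zpow_pos _).le

/-- The numerical series behind (28): for `β ≥ 3`, `Σ_{g=2}^{K} (g−1)·2^{2−(g−2)β} ≤ 8`
(`4` from the group `g = 2` and at most `4·Σ_{d≥1}(d+1)2^{−3d} < 4` from the rest).
[cite: UchinoOzakiImamura2025, §5.1 (derivation of eq. (28))] -/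
theorem series_le_eight {β : ℕ} (hβ : 3 ≤ β) (K : ℕ) :
    ∑ g ∈ Ico 2 (K + 1), ((g : ℚ) - 1) * (2 : ℚ) ^ (2 - ((g - 2 : ℕ) * β : ℤ)) ≤ 8 := by
  -- reindex `g = d + 2`
  have hre : ∑ g ∈ Ico 2 (K + 1), ((g : ℚ) - 1) * (2 : ℚ) ^ (2 - ((g - 2 : ℕ) * β : ℤ))
      = ∑ d ∈ range (K + 1 - 2), ((d : ℚ) + 1) * (2 : ℚ) ^ (2 - (d * β : ℕ) : ℤ) := by
    rw [sum_Ico_eq_sum_range]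
    refine sum_congr rfl fun d _ => ?_
    rw [show 2 + d - 2 = d by omega]
    push_cast
    ring_nf
  rw [hre]
  have hterm : ∀ d : ℕ, ((d : ℚ) + 1) * (2 : ℚ) ^ (2 - (d * β : ℕ) : ℤ) ≤ 4 * (1 / 4 : ℚ) ^ d := by
    intro d
    have h1 : (2 : ℚ) ^ (2 - (d * β : ℕ) : ℤ) ≤ 4 * ((1 / 8 : ℚ) ^ d) := by
      rw [show (2 - (d * β : ℕ) : ℤ) = 2 + -((d * β : ℕ) : ℤ) by ring, zpow_add₀ (by norm_num : (2:ℚ) ≠ 0),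
        zpow_neg, zpow_natCast, show (2 : ℚ) ^ (2 : ℤ) = 4 by norm_num]
      refine mul_le_mul_of_nonneg_left ?_ (by norm_num)
      rw [one_div, inv_pow, show (8 : ℚ) ^ d = 2 ^ (d * 3) by rw [mul_comm, pow_mul]; norm_num]
      exact inv_anti₀ (by positivity) (pow_le_pow_right₀ (by norm_num) (Nat.mul_le_mul_left d hβ))
    have h2 : ((d : ℚ) + 1) * (1 / 8 : ℚ) ^ d ≤ (1 / 4 : ℚ) ^ d := by
      rw [show (1 / 8 : ℚ) ^ d = (1 / 2) ^ d * (1 / 4) ^ d by rw [← mul_pow]; norm_num]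
      rw [← mul_assoc]
      refine mul_le_of_le_one_left (by positivity) ?_
      have : ((d : ℚ) + 1) ≤ 2 ^ d := by
        have := Nat.lt_two_pow_self (n := d)
        exact_mod_cast this
      calc ((d : ℚ) + 1) * (1 / 2 : ℚ) ^ d ≤ 2 ^ d * (1 / 2 : ℚ) ^ d :=
            mul_le_mul_of_nonneg_right this (by positivity)
        _ = 1 := by rw [← mul_pow]; norm_num
    calc ((d : ℚ) + 1) * (2 : ℚ) ^ (2 - (d * β : ℕ) : ℤ) ≤ ((d : ℚ) + 1) * (4 * (1 / 8 : ℚ) ^ d) :=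
          mul_le_mul_of_nonneg_left h1 (by positivity)
      _ = 4 * (((d : ℚ) + 1) * (1 / 8 : ℚ) ^ d) := by ring
      _ ≤ 4 * (1 / 4 : ℚ) ^ d := mul_le_mul_of_nonneg_left h2 (by norm_num)
  have hgeom : ∀ L : ℕ, ∑ d ∈ range L, 4 * (1 / 4 : ℚ) ^ d ≤ 16 / 3 * (1 - (1 / 4 : ℚ) ^ L) := by
    intro L
    induction L with
    | zero => simp
    | succ L ih => rw [sum_range_succ, pow_succ]; linarith
  calc ∑ d ∈ range (K + 1 - 2), ((d : ℚ) + 1) * (2 : ℚ) ^ (2 - (d * β : ℕ) : ℤ)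
      ≤ ∑ d ∈ range (K + 1 - 2), 4 * (1 / 4 : ℚ) ^ d := sum_le_sum fun d _ => hterm d
    _ ≤ 16 / 3 * (1 - (1 / 4 : ℚ) ^ (K + 1 - 2)) := hgeom _
    _ ≤ 8 := by
        have h0 : (0 : ℚ) ≤ (1 / 4 : ℚ) ^ (K + 1 - 2) := by positivity
        linarith

/-- EQS. (27)–(28): the sum of the absolute values of ALL the `n·½K(K−1)` products making up the leading
groups `s + t ≤ K` of entry `(i, j)` is at most `8n·gᵢfⱼ` when `β ≥ 3` (terms indexed 0-based:
`x s l = (A_{s+1})ᵢₗ`, `y t l = (B_{t+1})ₗⱼ`, bounds (17) in the form `|(A_s)ᵢₗ| ≤ 2^{e_{s−1}}`).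
[cite: UchinoOzakiImamura2025, §5.1 eqs. (27)–(28)] -/
theorem abs_sum_leading_le {β K : ℕ} (hβ : 3 ≤ β) {M N : ℤ} (x y : ℕ → Fin n → ℚ)
    (hx : ∀ s l, |x s l| ≤ (2 : ℚ) ^ lvl M β s) (hy : ∀ t l, |y t l| ≤ (2 : ℚ) ^ lvl N β t) :
    ∑ s ∈ range K, ∑ t ∈ range (K - 1 - s), ∑ l, |x s l * y t l|
      ≤ 8 * n * (2 : ℚ) ^ M * (2 : ℚ) ^ N := by
  have h2 : (2 : ℚ) ≠ 0 := by norm_num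
  -- each product of group `g = s + t + 2`
  have hprod : ∀ s t l, |x s l * y t l| ≤ (2 : ℚ) ^ (2 - ((s + t) * β : ℕ) : ℤ) * ((2 : ℚ) ^ M * (2 : ℚ) ^ N) := by
    intro s t l
    refine (abs_term_le (hx s l) (hy t l)).trans (le_of_eq ?_)
    unfold lvl
    rw [← zpow_add₀ h2, ← zpow_add₀ h2]; congr 1; push_cast; ring
  -- regroup by `g = s + t + 2`: the double sum over (s,t) with s + t ≤ K − 2 equals the sum over groups
  have hcount : ∑ s ∈ range K, ∑ t ∈ range (K - 1 - s), (2 : ℚ) ^ (2 - ((s + t) * β : ℕ) : ℤ)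
      = ∑ g ∈ Ico 2 (K + 1), ((g : ℚ) - 1) * (2 : ℚ) ^ (2 - ((g - 2 : ℕ) * β : ℤ)) := by
    -- both sides as functions of K satisfy the same recursion
    induction K with
    | zero => simp
    | succ K ih =>
        rw [sum_range_succ, show K + 1 - 1 - K = 0 by omega, sum_range_zero, add_zero]
        rcases Nat.eq_zero_or_pos K with rfl | hK
        · simp
        rw [sum_Ico_succ_top (by omega), ← ih]
        -- LHS(K+1) = Σ_{s<K} Σ_{t< K-s} = Σ_{s<K} (Σ_{t<K-1-s} + term(t = K-1-s))
        have : ∑ s ∈ range K, ∑ t ∈ range (K + 1 - 1 - s), (2 : ℚ) ^ (2 - ((s + t) * β : ℕ) : ℤ)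
            = ∑ s ∈ range K, (∑ t ∈ range (K - 1 - s), (2 : ℚ) ^ (2 - ((s + t) * β : ℕ) : ℤ))
              + ∑ s ∈ range K, (2 : ℚ) ^ (2 - (((K - 1) * β : ℕ) : ℤ)) := by
          rw [← sum_add_distrib]
          refine sum_congr rfl fun s hs => ?_
          rw [mem_range] at hs
          rw [show K + 1 - 1 - s = (K - 1 - s) + 1 by omega, sum_range_succ]
          congr 2
          rw [show s + (K - 1 - s) = K - 1 by omega]
        rw [this, sum_const, card_range, nsmul_eq_mul]
        congr 1
        rw [show (K + 1 - 2 : ℕ) = K - 1 by omega]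
        push_cast [Nat.one_le_iff_ne_zero.mpr hK.ne']
        ring
  calc ∑ s ∈ range K, ∑ t ∈ range (K - 1 - s), ∑ l, |x s l * y t l|
      ≤ ∑ s ∈ range K, ∑ t ∈ range (K - 1 - s), ∑ _l : Fin n,
          (2 : ℚ) ^ (2 - ((s + t) * β : ℕ) : ℤ) * ((2 : ℚ) ^ M * (2 : ℚ) ^ N) :=
        sum_le_sum fun s _ => sum_le_sum fun t _ => sum_le_sum fun l _ => hprod s t l
    _ = (n : ℚ) * ((2 : ℚ) ^ M * (2 : ℚ) ^ N)
          * ∑ s ∈ range K, ∑ t ∈ range (K - 1 - s), (2 : ℚ) ^ (2 - ((s + t) * β : ℕ) : ℤ) := by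
        rw [mul_sum]
        refine sum_congr rfl fun s _ => ?_
        rw [mul_sum]
        refine sum_congr rfl fun t _ => ?_
        rw [sum_const, card_univ, Fintype.card_fin, nsmul_eq_mul]; ring
    _ ≤ (n : ℚ) * ((2 : ℚ) ^ M * (2 : ℚ) ^ N) * 8 := by
        rw [hcount]
        exact mul_le_mul_of_nonneg_left (series_le_eight hβ K) (by positivity)
    _ = 8 * n * (2 : ℚ) ^ M * (2 : ℚ) ^ N := by ring

/-- EQ. (29) ⟹ the capacity condition of the grid argument: `2u·ufp(8n) ≤ 2^{2−βK}` gives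
`8n ≤ 2^p·2^{2−βK}` (as `8n < 2ufp(8n)`). [cite: UchinoOzakiImamura2025, §5.1 eqs. (15), (29)] -/
theorem capacity_of_errorfree_condition {β K : ℕ} (hn : 0 < n)
    (h : 2 * unitRoundoff p * ufp (8 * (n : ℚ)) ≤ (2 : ℚ) ^ (2 - (β * K : ℕ) : ℤ)) :
    8 * (n : ℚ) ≤ (2 : ℚ) ^ (p : ℤ) * (2 : ℚ) ^ (2 - (β * K : ℕ) : ℤ) := by
  have h8 : (8 : ℚ) * n ≠ 0 := by positivity
  have hlt := abs_lt_two_mul_ufp h8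
  rw [abs_of_pos (by positivity)] at hlt
  have hu : unitRoundoff p = ((2 : ℚ) ^ (p : ℤ))⁻¹ := by unfold unitRoundoff; rw [zpow_natCast, one_div]
  rw [hu] at h
  have h2p : (0 : ℚ) < (2 : ℚ) ^ (p : ℤ) := two_zpow_pos _
  have : 2 * ufp (8 * (n : ℚ)) ≤ (2 : ℚ) ^ (p : ℤ) * (2 : ℚ) ^ (2 - (β * K : ℕ) : ℤ) := by
    have := mul_le_mul_of_nonneg_left h h2p.le
    rw [show (2 : ℚ) ^ (p : ℤ) * (2 * ((2 : ℚ) ^ (p : ℤ))⁻¹ * ufp (8 * (n : ℚ))) = 2 * ufp (8 * (n : ℚ)) by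
      field_simp] at this
    exact this
  linarith

/-- EQS. (23)–(29), THE ERROR-FREE LEADING GROUPS, in the strong form: let the terms of entry `(i, j)` of
the leading groups `s + t ≤ K` (`K = k' + 1`; 0-based `x s l = (A_{s+1})ᵢₗ`, `y t l = (B_{t+1})ₗⱼ`) satisfy
the grid (24) and the bounds (17), let `β ≥ 3`, no underflow on the grid `2^{Mᵢ+Nⱼ+2−βK}` and the
condition (29) `2u·ufp(8n) ≤ 2^{2−βK}`. Then not only is `Σ_{s+t≤k'+1} A_sB_t ∈ F` (23): EVERY
floating-point evaluation `T` of that partial accumulation or of any part of it — leaves among those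
products (`s + t + 2 ≤ K`, so `Σ|leaves| ≤` the full triple sum), the `n` products of each slice pair
and the slice pairs in any order and blocking, products rounded or fused — returns its exact value,
which is a floating-point number ("no rounding error occurs" for the leading groups).
[cite: UchinoOzakiImamura2025, §5.1 eqs. (23)–(29)] -/
theorem leading_groups_exact (hp : 1 ≤ p) (hfl : IsRoundNearest p emin fl) {β K : ℕ} (hβ : 3 ≤ β)
    (hn : 0 < n) {M N : ℤ} (x y : ℕ → Fin n → ℚ)
    (hgx : ∀ s l, OnGrid ((2 : ℚ) ^ lvl M β (s + 1)) (x s l))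
    (hgy : ∀ t l, OnGrid ((2 : ℚ) ^ lvl N β (t + 1)) (y t l))
    (hx : ∀ s l, |x s l| ≤ (2 : ℚ) ^ lvl M β s) (hy : ∀ t l, |y t l| ≤ (2 : ℚ) ^ lvl N β t)
    (he : emin ≤ M + N + 2 - (β * K : ℕ))
    (hcond : 2 * unitRoundoff p * ufp (8 * (n : ℚ)) ≤ (2 : ℚ) ^ (2 - (β * K : ℕ) : ℤ))
    (T : DotTree) (hmem : ∀ z ∈ T.leaves, ∃ s t l, s + t + 2 ≤ K ∧ z = x s l * y t l)
    (hsum : T.absSum ≤ ∑ s ∈ range K, ∑ t ∈ range (K - 1 - s), ∑ l, |x s l * y t l|) :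
    T.eval fl = T.exact ∧ IsFloat p emin T.exact := by
  have hgrid : ∀ z ∈ T.leaves, OnGrid ((2 : ℚ) ^ (M + N + 2 - (β * K : ℕ))) z := by
    intro z hz
    obtain ⟨s, t, l, hst, rfl⟩ := hmem z hz
    exact onGrid_term_coarse (by omega) (hgx s l) (hgy t l)
  have habs : T.absSum ≤ (2 : ℚ) ^ p * (2 : ℚ) ^ (M + N + 2 - (β * K : ℕ)) := by
    refine hsum.trans ?_
    refine (abs_sum_leading_le hβ x y hx hy).trans ?_
    have hc := capacity_of_errorfree_condition (p := p) hn hcond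
    have : (2 : ℚ) ^ (M + N + 2 - (β * K : ℕ)) = (2 : ℚ) ^ (2 - (β * K : ℕ) : ℤ) * ((2 : ℚ) ^ M * (2 : ℚ) ^ N) := by
      rw [← zpow_add₀ (by norm_num : (2:ℚ) ≠ 0), ← zpow_add₀ (by norm_num : (2:ℚ) ≠ 0)]; congr 1; ring
    rw [this, zpow_natCast] at *
    have hMN : (0 : ℚ) ≤ (2 : ℚ) ^ M * (2 : ℚ) ^ N := by positivity
    calc 8 * (n : ℚ) * (2 : ℚ) ^ M * (2 : ℚ) ^ N = (8 * (n : ℚ)) * ((2 : ℚ) ^ M * (2 : ℚ) ^ N) := by ring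
      _ ≤ ((2 : ℚ) ^ p * (2 : ℚ) ^ (2 - (β * K : ℕ) : ℤ)) * ((2 : ℚ) ^ M * (2 : ℚ) ^ N) :=
          mul_le_mul_of_nonneg_right hc hMN
      _ = _ := by ring
  have h1 := dotTree_eval_eq_exact hp hfl he T hgrid habs
  refine ⟨h1, ?_⟩
  refine isFloat_of_onGrid_two_zpow hp ?_ ((DotTree.abs_exact_le_absSum T).trans habs) he
  rw [DotTree.exact_eq_sum]
  exact onGrid_list_sum hgrid

/-- (23)–(29) FOR THE BIT-MASK SLICES THEMSELVES: the terms `(A_{s+1})ᵢₗ(B_{t+1})ₗⱼ` of the scheme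
(`sliceM`, `sliceMc`) satisfy (24) and (17) — for ANY choice of the scales `Mᵢ`, `Nⱼ`, which matter
only for (5) and (16) — so under `β ≥ 3`, (29) and no underflow every evaluation of (any part of) the
leading groups `s + t + 2 ≤ K` of entry `(i, j)` is exact. [cite: UchinoOzakiImamura2025, §5.1 eqs. (23)–(29)] -/
theorem leading_groups_exact_bitmask (hp : 1 ≤ p) (hfl : IsRoundNearest p emin fl) {β K : ℕ} (hβ : 3 ≤ β)
    (hn : 0 < n) (A : Matrix (Fin m) (Fin n) ℚ) (B : Matrix (Fin n) (Fin q) ℚ) (M : Fin m → ℤ)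
    (N : Fin q → ℤ) (i : Fin m) (j : Fin q) (he : emin ≤ M i + N j + 2 - (β * K : ℕ))
    (hcond : 2 * unitRoundoff p * ufp (8 * (n : ℚ)) ≤ (2 : ℚ) ^ (2 - (β * K : ℕ) : ℤ)) (T : DotTree)
    (hmem : ∀ z ∈ T.leaves, ∃ s t l, s + t + 2 ≤ K ∧ z = sliceM A M β (s + 1) i l * sliceMc B N β (t + 1) l j)
    (hsum : T.absSum ≤ ∑ s ∈ range K, ∑ t ∈ range (K - 1 - s), ∑ l,
      |sliceM A M β (s + 1) i l * sliceMc B N β (t + 1) l j|) :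
    T.eval fl = T.exact ∧ IsFloat p emin T.exact :=
  leading_groups_exact hp hfl hβ hn (fun s l => sliceM A M β (s + 1) i l) (fun t l => sliceMc B N β (t + 1) l j)
    (fun s l => onGrid_partEntry (M i) β (s + 1) (A i l)) (fun t l => onGrid_partEntry (N j) β (t + 1) (B l j))
    (fun s l => (abs_partEntry_le (M i) β s (A i l)).2.le) (fun t l => (abs_partEntry_le (N j) β t (B l j)).2.le)
    he hcond T hmem hsum

/-- EQ. (30), THE IMPROVED ACCUMULATION CONSTANT — in the form the count of inexact additions gives.
Sum the leading groups `s + t ≤ k'+1` first (exactly, `leading_groups_exact`: their total `c₀` is ONE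
float) and then `c₀` and the remaining `R = ½k(k+1) − ½k'(k'+1)` terms in any order: the error is at most
`R·u·(|c₀| + Σ_rest|AᵢBⱼ|) ≤ (½k(k+1) − ½k'(k'+1))·u·|A||B|`. AS PRINTED, (30) has the constant
`½k(k+1) − ½k'ₘₐₓ(k'ₘₐₓ+1) − 1`, one unit smaller; the any-order argument from (14) yields
`(number of summands − 1) = R` with the exact leading block counted as one summand, and we could not
justify the extra `−1` (for `k' = 1` the printed constant is below the plain (22)); we record the bound
with constant `R`. [cite: UchinoOzakiImamura2025, §5.1 eq. (30)] -/
theorem accumulation_bound_improved (hp : 2 ≤ p) (hfl : IsRoundNearest p emin fl) (T : SumTree)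
    (hT : ∀ x ∈ T.leaves, IsFloat p emin x) {k k' : ℕ} (hlen : T.leaves.length + (k' * (k' + 1)) / 2 = k * (k + 1) / 2 + 1)
    {S : ℚ} (hS : (T.leaves.map abs).sum ≤ S) :
    |T.exact - T.eval fl| ≤ ((k * (k + 1) / 2 : ℕ) - ((k' * (k' + 1) / 2 : ℕ) : ℚ)) * unitRoundoff p * S := by
  have h := accumulation_bound hp hfl T hT
  have hl : ((T.leaves.length : ℚ) - 1) = ((k * (k + 1) / 2 : ℕ) - ((k' * (k' + 1) / 2 : ℕ) : ℚ)) := by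
    have : (T.leaves.length : ℚ) + ((k' * (k' + 1) / 2 : ℕ) : ℚ) = ((k * (k + 1) / 2 : ℕ) : ℚ) + 1 := by
      exact_mod_cast hlen
    linarith
  rw [hl] at h
  refine h.trans (mul_le_mul_of_nonneg_left hS (mul_nonneg ?_ (unitRoundoff_pos p).le))
  rw [← hl]
  have := SumTree.one_le_length_leaves T
  have : (1 : ℚ) ≤ T.leaves.length := by exact_mod_cast this
  linarith

end ErrorFree

/-! ### §5.2: the number `w` of FP64 summands of Algorithm 5 and its `(w − 1)u` bound -/

/-- THE CHUNK COUNT of the group-wise accumulation (Algorithm 5), block form: group `g` has `g − 1`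
products and is flushed to FP64 in `⌈(g−1)/r⌉` chunks; over the groups with `1, …, qr + ρ` products
(`0 ≤ ρ ≤ r`) that makes `Σ_{c=1}^{qr+ρ}⌈c/r⌉ = r·q(q+1)/2 + (q+1)ρ` FP64 summands (doubled to stay in `ℕ`;
`⌈c/r⌉ = (c + r − 1)/r`, here with `c = c₀ + 1`). [cite: UchinoOzakiImamura2025, §5.2 (definition of w)] -/
theorem chunk_count_blocks {r : ℕ} (hr : 1 ≤ r) : ∀ (q ρ : ℕ), ρ ≤ r →
    2 * ∑ c ∈ range (q * r + ρ), (c + r) / r = r * q * (q + 1) + 2 * (q + 1) * ρ := by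
  have hceil : ∀ q ρ : ℕ, ρ < r → (q * r + ρ + r) / r = q + 1 := by
    intro q ρ hρ
    rw [show q * r + ρ + r = ρ + (q + 1) * r by ring, Nat.add_mul_div_right _ _ (by omega),
      Nat.div_eq_of_lt hρ, zero_add]
  intro q
  induction q with
  | zero =>
      intro ρ hρ
      induction ρ with
      | zero => simp
      | succ ρ ih =>
          have := ih (by omega)
          rw [show 0 * r + (ρ + 1) = (0 * r + ρ) + 1 by ring, sum_range_succ, mul_add, this, hceil 0 ρ (by omega)]
          ring
  | succ q ihq =>
      intro ρ hρ
      induction ρ with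
      | zero =>
          have := ihq r le_rfl
          rw [show (q + 1) * r + 0 = q * r + r by ring, this]; ring
      | succ ρ ih =>
          have := ih (by omega)
          rw [show (q + 1) * r + (ρ + 1) = ((q + 1) * r + ρ) + 1 by ring, sum_range_succ, mul_add, this,
            hceil (q + 1) ρ (by omega)]
          ring

/-- THE PAPER'S CLOSED FORM: for `k ≥ 1` slices the FP64 accumulation of Algorithm 5 has
`w := ⌈k/r⌉·(k − (r/2)⌊(k−1)/r⌋) = Σ_{c=1}^{k}⌈c/r⌉` summands (doubled: `2w = ⌈k/r⌉(2k − r⌊(k−1)/r⌋)`).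
[cite: UchinoOzakiImamura2025, §5.2 (definition of w)] -/
theorem chunk_count {r k : ℕ} (hr : 1 ≤ r) (hk : 1 ≤ k) :
    2 * ∑ c ∈ range k, (c + r) / r = ((k + r - 1) / r) * (2 * k - r * ((k - 1) / r)) := by
  set q := (k - 1) / r with hq
  have hmod := Nat.div_add_mod (k - 1) r
  have hlt := Nat.mod_lt (k - 1) (show 0 < r by omega)
  set ρ := (k - 1) % r + 1 with hρ
  have hk' : k = q * r + ρ := by rw [hρ, hq]; rw [mul_comm]; omega
  have h1 : (k + r - 1) / r = q + 1 := by
    rw [show k + r - 1 = (k - 1) + r by omega, Nat.add_div_right _ (by omega)]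
  have h2 := chunk_count_blocks hr q ρ (by omega)
  rw [← hk'] at h2
  rw [h2, h1]
  have h3 : r * q ≤ 2 * k := by rw [hk']; nlinarith
  zify [h3]
  rw [hk']; push_cast; ring

/-- §5.2 FINAL: with the group-wise error-free accumulation the FP64 sum has `w` summands — each an exactly
computed chunk `2^{2−βg}μ''ᵢν''ⱼ·Σ_{chunk}(A''ₛB''_{g−s})ᵢⱼ` (a float, `isFloat_int_mul_two_zpow`), whose
absolute values add up to at most `Σ|AᵢBⱼ|ᵢⱼ ≤ (|A||B|)ᵢⱼ` — so, in any order,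
`|Σ AᵢBⱼ − T|ᵢⱼ ≤ (w − 1)u(|A||B|)ᵢⱼ`; with (18): `|AB − T| ≤ 4(k+1)n2^{−βk}g fᵀ + (w−1)u|A||B|`.
[cite: UchinoOzakiImamura2025, §5.2 (final bound)] -/
theorem groupwise_accumulation_bound (hp : 2 ≤ p) (hfl : IsRoundNearest p emin fl) (T : SumTree)
    (hT : ∀ x ∈ T.leaves, IsFloat p emin x) {w : ℕ} (hw : T.leaves.length = w) {S : ℚ}
    (hS : (T.leaves.map abs).sum ≤ S) :
    |T.exact - T.eval fl| ≤ ((w : ℚ) - 1) * unitRoundoff p * S := by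
  have h := accumulation_bound hp hfl T hT
  rw [hw] at h
  refine h.trans (mul_le_mul_of_nonneg_left hS (mul_nonneg ?_ (unitRoundoff_pos p).le))
  have := SumTree.one_le_length_leaves T
  rw [hw] at this
  have : (1 : ℚ) ≤ w := by exact_mod_cast this
  linarith

/-- THE TWO ERROR SOURCES TOGETHER, eq. (13) with (18) and (22)/(30)/§5.2: for an entry,
`|(AB)ᵢⱼ − Tᵢⱼ| ≤ |(AB − Σ AᵢBⱼ)ᵢⱼ| + |(Σ AᵢBⱼ)ᵢⱼ − Tᵢⱼ| ≤ τ + α` whenever the truncation part is `≤ τ`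
and the accumulation part is `≤ α`. [cite: UchinoOzakiImamura2025, §5 eq. (13) and §5.1 (summary)] -/
theorem total_bound {ab sum t τ α : ℚ} (h1 : |ab - sum| ≤ τ) (h2 : |sum - t| ≤ α) : |ab - t| ≤ τ + α := by
  calc |ab - t| = |(ab - sum) + (sum - t)| := by ring_nf
    _ ≤ |ab - sum| + |sum - t| := abs_add_le _ _
    _ ≤ τ + α := add_le_add h1 h2

end Literature.ComputerArithmetic.UchinoOzakiImamura2025
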